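/-
Copyright (c) 2026. All rights reserved.
Released under Apache 2.0 license as described in the file LICENSE.
Authors: abc-iut cell, statement-typer seat abc-iut-L4-t3 (wave 1; gen 9), owner of the §5 interface, over abc-iut-L4-t8's
`𝒞^hol_{TH⊞}` (`ArchimedeanHolGroupPairs*`), abc-iut-w4-d095's `archGenuine`, abc-iut-w6-d025's arc chart / `An⊢` machinery.
-/
import Literature.AnabelianGeometry.AbsoluteAnabelian.Ltimes.LogFrobeniusMonoAnalyticization
import Literature.AnabelianGeometry.AbsoluteAnabelian.Ltimes.LogFrobeniusRestrict
import Literature.AnabelianGeometry.AbsoluteAnabelian.AutHolFieldFunctorMonoAnalyticization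
import Literature.AnabelianGeometry.AbsoluteAnabelian.ArchimedeanHolGroupPairsLambda
import Literature.AnabelianGeometry.AbsoluteAnabelian.ArchimedeanHolGroupPairsTBPlusFunctor
import Literature.AnabelianGeometry.AbsoluteAnabelian.TBPlusULift
import HarnessLib

/-!
# [AbsTopIII] Def 5.4 (v)–(vii), Def 5.6 (iv), Prop 5.8 (vii): the §5 carrier with GENUINE archimedean `⊞`-rows over the `⋉`-successor

S. Mochizuki, *Topics in absolute anabelian geometry III*, J. Math. Sci. Univ. Tokyo 22 (2015) [MochizukiAbsTopIII2015];
manuscript `paper:url-5493eb38cbb7`, read on the page (own render): Def 5.4 (v) p. 127 l. 53–64 (the archimedean diagram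
`k~ →(id) k~ →(shell) k^× ↪ k`; "`Γ⃗^⋉_arc` … may be considered … in `TH⊞`"), (vi) p. 128 l. 14–44 (`𝒩⊞_v := Orb(𝒞^hol_{TH⊞})
×_{Orb(EA),v} Th•[Z]`; `λ⊞_{v,ν}` for `ν ∈ Γ⃗^×_v` "the object at the vertex `ν`", for the space-link / post-log vertex "the
underlying additive topological group of the field"), (vii) p. 128 l. 45–55 (`ι⊞_{v,ε}` for the edges of `Γ⃗^⋉_v`), Def 5.6 (iv)
p. 136 (the mono-analyticization `𝒞^hol_{TH⊞} → 𝒞^{hol⊢}_{TB⊞}`, reading the `TB⊞`-object off the Kummer structure), Prop 5.8 (vii)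
p. 141 (`An⊢[𝒩⊢⊞_w]`, `ψ^{An⊢⊞}_{w,ν}`).

## What this file builds (cell row «LTIMES-SUCCESSOR» S3a; typing finding T3g9-F1; L4-lead m162/m169/m170 (M1))

Over the FROZEN interface no carrier can have print's archimedean `TH⊞`-shapes (`LogFrobeniusArchPlusNoGo.lean`: the frozen
`ι⊞` along `k^× ↪ k`).  Over the successor `LogFrobeniusSettingLtimes` (`ι⊞` on `Γ⃗^⋉_v` only) it exists, and this file builds
it, at an all-archimedean index (the nonarchimedean places enter through abc-iut-w6-d025's sum carrier):

* `LogFrobeniusSettingLtimes.archPlus 𝔄 Vmod` — `𝒳 := 𝒞^hol_TF` (abc-iut-L4-t2's Aut-holomorphic pairs `HolTFPair 𝔄`, lifted),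
  `ℰ• := EA`, **`𝒩⊞_v := 𝒞^hol_{TH⊞}`-pairs** (abc-iut-L4-t8's `HolTHPlusPair 𝔄`: a connected Aut-holomorphic GROUP with its Kummer
  structure, shapes `k~`/`k^×`), `λ⊞_{v,k~} = λ⊞_{v,post-log} = λ⊞_{v,space-link} := λ⊞^∼` ("the underlying additive topological
  group of the field", `HolTFPair.lamSimPlus`), `λ⊞_{v,k^×} := λ⊞^×` (`lamTimesPlus`), `ι⊞` along `k~ →(id) k~` the identity and along
  the shell-arrow `k~ ↠ k^×` the exponential `HolTFPair.iotaTimesPlus` — and NO `ι⊞` along `k^× ↪ k` (not an edge of `Γ⃗^⋉_arc`);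
  `ℰ⊢ := TM⊢` with the GENUINE `EA → TM⊢` (abc-iut-w6-d025's `toTMMono`), **`𝒩⊢⊞_v := TM⊢ × TB⊞` with the GENUINE
  mono-analyticization `𝒩⊞_v → 𝒩⊢⊞_v`, `(𝕏 ↶ M) ↦ (G_𝕏, M read as a TB⊞-object via its Kummer structure)`** (Def 5.6 (iv): abc-iut-L4-t8's
  `HolTHPlusPair.toTBPlus`, lifted one universe by `TBPlus.uliftFunctor`), `An⊢[𝒩⊢⊞] := TMMono.AnArc` with print's `ψ^{An⊢⊞}_{w,ν}`
  (`TMMono.ψArc`: `k~(G)` at `pre`, `k^×(G)` at `mult`); `An•[𝒳] := LinHol` (abc-iut-w4-d095's `archGenuine`, reused via `toLtimes`);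
* `rfl` bookkeeping (`archPlus_lam_pre/_mult`, `_ψAnMono`, `_monoNplus`, `_ψOver`, `_monoN_toEmono_eq`), the add-on
  `archPlus_monoAnalyticizationHomotopies`, and **Cor 5.10 (iv)(a) at the carrier** (`archPlus_cor510MonoCores`, zero hypotheses
  for `V ≠ ∅`), `exists_archPlus`.

HONEST LIMITS (named): (L-N) `𝒩_v := 𝒩⊞_v` and `𝒩⊢_v := 𝒩⊢⊞_v` (the forgetful `𝒩⊞_v → 𝒩_v`, `𝒩⊢⊞_v → 𝒩⊢_v` are identities; print
forgets the `⊞`-datum to `𝒞^hol_TH` / `TB` = orientable topological orbisurfaces, Def 5.6 (i) — not typed in the tree; no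
statement of Cor 5.10 (iv)(a)–(c) reads these rows beyond "lies over `ℰ•`/`ℰ⊢`"); (L-Orb) print's `Orb(−)` coarsification is not
applied (abc-iut-w5-d038: strict naturality of `η⊢` then needs an orientation cochain — supplied where `η⊢` is built, not here);
(L-arc) all-archimedean index.  MODEL-LEVEL over the interface `AutHolFieldFunctor`; refereed pre-IUT material; a carrier of OUR
successor typing; nothing here bears on [IUTchIII] Cor. 3.12; no side taken; typed ≠ proved.
-/

set_option autoImplicit false

noncomputable section

open CategoryTheory

universe u

namespace Literature.AnabelianGeometry.AbsoluteAnabelian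

namespace LogFrobeniusSettingLtimes

variable (𝔄 : AutHolFieldFunctor.{u})

/-! ## The archimedean `λ⊞` and `ι⊞` of Def 5.4 (v)–(vii) in `𝒞^hol_{TH⊞}` -/

/-- `λ⊞_{v,ν} : 𝒞^hol_TF → 𝒞^hol_{TH⊞}` at an archimedean place (Def 5.4 (vi)): `k^× ↦ λ⊞^×`; the pre-log `k~`, the post-log `k~` and
the space-link `k` ↦ `λ⊞^∼` ("the underlying additive topological group of the field"). [cite: MochizukiAbsTopIII2015, Def 5.4 (vi) p. 128] -/
def archPlusLam : ArchVertex → (Up (HolTFPair 𝔄) ⥤ Up (HolTHPlusPair 𝔄))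
  | .mult => Up.liftF (HolTFPair.lamTimesPlus 𝔄)
  | .pre => Up.liftF (HolTFPair.lamSimPlus 𝔄)
  | .postLog => Up.liftF (HolTFPair.lamSimPlus 𝔄)
  | .spaceLink => Up.liftF (HolTFPair.lamSimPlus 𝔄)

/-- `Λ_ν ⋙ λ = λ` for the identity log-Frobenius functor of the model. [cite: MochizukiAbsTopIII2015, Def 5.4 (vii) p. 128] -/
theorem frobeniusTwist_id_comp_archPlusLam (b : Bool) (ν : ArchVertex) :
    frobeniusTwist (𝟭 (Up (HolTFPair 𝔄))) b ⋙ archPlusLam 𝔄 ν = archPlusLam 𝔄 ν := by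
  cases b <;> rfl

/-- `ι⊞_{v,ε}` for the edges of `Γ⃗^⋉_arc` (Def 5.4 (vii)): along `k~ →(id) k~` the identity, along the shell-arrow `k~ ↠ k^×` the
exponential `ι⊞^×` of `𝒞^hol_{TH⊞}` (`HolTFPair.iotaTimesPlus`); the space-link arrow `k^× ↪ k` is NOT an edge of `Γ⃗^⋉_arc`.
[cite: MochizukiAbsTopIII2015, Def 5.4 (vii) p. 128] -/
def archPlusIota : {ν₁ ν₂ : ArchVertex} → (ε : {e : ArchEdge ν₁ ν₂ // e.InLeft}) →
    (frobeniusTwist (𝟭 (Up (HolTFPair 𝔄))) (LogVertex.isPostLog (b := true) ν₁) ⋙ archPlusLam 𝔄 ν₁ ⟶ archPlusLam 𝔄 ν₂)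
  | _, _, ⟨.postLogId, _⟩ => eqToHom (frobeniusTwist_id_comp_archPlusLam 𝔄 _ _)
  | _, _, ⟨.shell, _⟩ => eqToHom (frobeniusTwist_id_comp_archPlusLam 𝔄 _ _) ≫ Up.liftT (HolTFPair.iotaTimesPlus 𝔄)
  | _, _, ⟨.multToSpaceLink, h⟩ => h.elim

/-- `λ⊞_{v,ν}` lies over `EA` ON THE NOSE (`(𝕏 ↶ M) ↦ 𝕏` after `λ⊞^∼`/`λ⊞^×` is `(𝕏 ↶ k) ↦ 𝕏`). [cite: MochizukiAbsTopIII2015, Def 5.4 (vi) p. 128] -/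
theorem archPlusLam_toEA (ν : ArchVertex) :
    archPlusLam 𝔄 ν ⋙ 𝟭 _ ⋙ Up.liftF (HolTHPlusPair.toEA 𝔄) = Up.liftF (HolTFPair.toEA 𝔄) := by
  cases ν <;> rfl

/-- **The mono-analyticization `𝒩⊞_v → 𝒩⊢⊞_v = TM⊢ × TB⊞`** (Def 5.6 (iv)), GENUINE: `(𝕏 ↶ M) ↦ (G_𝕏, M)` with `G_𝕏` abc-iut-w6-d025's
`(𝒪^▷_{𝒜_𝕏}, 𝒪^▷ ∩ ℝ_{>0})` and `M` read as a `TB⊞`-object through its Kummer structure (abc-iut-L4-t8's `toTBPlus`, lifted one universe).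
[cite: MochizukiAbsTopIII2015, Def 5.6 (iv) p. 136] -/
def archPlusMono : Up (HolTHPlusPair 𝔄) ⥤ TMMono.{u + 1} × TBPlus.{u + 1} :=
  inducedFunctor _ ⋙ (HolTHPlusPair.toEA 𝔄 ⋙ 𝔄.toTMMono).prod' (HolTHPlusPair.toTBPlus 𝔄 ⋙ TBPlus.uliftFunctor.{u + 1})

variable (Vmod : Type (u + 1))

/-! ## The carrier -/

/-- ★ **The §5 carrier with GENUINE archimedean `⊞`-rows over the `⋉`-successor** (module docstring), over an all-archimedean
index: the holomorphic rows `𝒳`, `ℰ•`, `An•[𝒳]` of abc-iut-w4-d095's `archGenuine` (restricted by `toLtimes`), with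
`𝒩⊞_v := 𝒞^hol_{TH⊞}`-pairs, print's `λ⊞`/`ι⊞` on `Γ⃗^⋉_arc`, the genuine `ℰ• → ℰ⊢ = TM⊢`, the genuine `𝒩⊞_v → 𝒩⊢⊞_v = TM⊢ × TB⊞`,
and print's `An⊢[𝒩⊢⊞_w]`, `ψ^{An⊢⊞}_{w,ν}`; honest limits (L-N), (L-Orb), (L-arc). [cite: MochizukiAbsTopIII2015, Def 5.4 (vi) p. 128] -/
def archPlus : LogFrobeniusSettingLtimes Vmod (fun _ => true) :=
  { (LogFrobeniusSetting.archGenuine 𝔄 Vmod (fun _ => true)).toLtimes with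
    Nplus := fun _ => Up (HolTHPlusPair 𝔄)
    catNplus := fun _ => inferInstance
    N := fun _ => Up (HolTHPlusPair 𝔄)
    catN := fun _ => inferInstance
    forget := fun _ => 𝟭 _
    toE := fun _ => Up.liftF (HolTHPlusPair.toEA 𝔄)
    lam := fun _ ν => archPlusLam 𝔄 ν
    lamOver := fun _ ν => eqToIso (archPlusLam_toEA 𝔄 ν)
    lam_spaceLink_eq_postLog := fun _ => rfl
    iota := fun _ _ _ ε => archPlusIota 𝔄 ε
    Emono := TMMono.{u + 1}
    catEmono := inferInstance
    monoAn := inducedFunctor _ ⋙ 𝔄.toTMMono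
    NmonoPlus := fun _ => TMMono.{u + 1} × TBPlus.{u + 1}
    catNmonoPlus := fun _ => inferInstance
    Nmono := fun _ => TMMono.{u + 1} × TBPlus.{u + 1}
    catNmono := fun _ => inferInstance
    forgetMono := fun _ => 𝟭 _
    toEmono := fun _ => CategoryTheory.Prod.fst TMMono.{u + 1} TBPlus.{u + 1}
    monoNplus := fun _ => archPlusMono 𝔄
    monoN := fun _ => archPlusMono 𝔄
    monoHomotopy := fun _ => Iso.refl _
    AnMono := TMMono.AnArc.{u + 1}
    catAnMono := inferInstance
    κAnMono := TMMono.anArcEquiv.{u + 1}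
    ψAnMono := fun _ ν => TMMono.ψArc true ν.1 }

/-! ## Bookkeeping (`rfl`) -/

/-- `𝒳 = 𝒞^hol_TF` (lifted). [cite: MochizukiAbsTopIII2015, Def 5.4 (i) p. 125] -/
theorem archPlus_X : (archPlus 𝔄 Vmod).X = Up (HolTFPair 𝔄) := rfl

/-- `𝒩⊞_v = 𝒞^hol_{TH⊞}` (lifted). [cite: MochizukiAbsTopIII2015, Def 5.4 (vi) p. 128] -/
theorem archPlus_Nplus (v : Vmod) : (archPlus 𝔄 Vmod).Nplus v = Up (HolTHPlusPair 𝔄) := rfl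

/-- `λ⊞` of the carrier is `archPlusLam`. [cite: MochizukiAbsTopIII2015, Def 5.4 (vi) p. 128] -/
theorem archPlus_lam (v : Vmod) (ν : ArchVertex) : (archPlus 𝔄 Vmod).lam v ν = archPlusLam 𝔄 ν := rfl

/-- `λ⊞_{v,k~} = λ⊞^∼`. [cite: MochizukiAbsTopIII2015, Def 5.4 (vi) p. 128] -/
theorem archPlus_lam_pre (v : Vmod) : (archPlus 𝔄 Vmod).lam v ArchVertex.pre = Up.liftF (HolTFPair.lamSimPlus 𝔄) := rfl

/-- `λ⊞_{v,k^×} = λ⊞^×`. [cite: MochizukiAbsTopIII2015, Def 5.4 (vi) p. 128] -/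
theorem archPlus_lam_mult (v : Vmod) : (archPlus 𝔄 Vmod).lam v ArchVertex.mult = Up.liftF (HolTFPair.lamTimesPlus 𝔄) := rfl

/-- `ι⊞` of the carrier is `archPlusIota` (identity along `k~ →(id) k~`, the exponential `ι⊞^×` along the shell-arrow).
[cite: MochizukiAbsTopIII2015, Def 5.4 (vii) p. 128] -/
theorem archPlus_iota (v : Vmod) {ν₁ ν₂ : ArchVertex} (ε : {e : ArchEdge ν₁ ν₂ // e.InLeft}) :
    (archPlus 𝔄 Vmod).iota v (ν₁ := ν₁) (ν₂ := ν₂) ε = archPlusIota 𝔄 ε := rfl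

/-- `𝒩⊞_v → 𝒩⊢⊞_v` of the carrier is the genuine `archPlusMono`. [cite: MochizukiAbsTopIII2015, Def 5.6 (iv) p. 136] -/
theorem archPlus_monoNplus (v : Vmod) : (archPlus 𝔄 Vmod).monoNplus v = archPlusMono 𝔄 := rfl

/-- `ℰ• → ℰ⊢` of the carrier is the genuine `toTMMono`. [cite: MochizukiAbsTopIII2015, Def 5.6 (ii) p. 135] -/
theorem archPlus_monoAn : (archPlus 𝔄 Vmod).monoAn = inducedFunctor _ ⋙ 𝔄.toTMMono := rfl

/-- `ψ^{An⊢⊞}_{w,ν}` of the carrier IS abc-iut-w6-d025's genuine `ψArc`. [cite: MochizukiAbsTopIII2015, Prop 5.8 (vii) p. 141] -/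
theorem archPlus_ψAnMono (w : Vmod) (ν : {ν : LogVertex true // ν.IsCross}) :
    (archPlus 𝔄 Vmod).ψAnMono w ν = TMMono.ψArc true ν.1 := rfl

/-- `ψ^{An⊢⊞}_{w,ν}` lies over `ℰ⊢` ON THE NOSE. [cite: MochizukiAbsTopIII2015, Prop 5.8 (vii) p. 141] -/
theorem archPlus_ψOver (w : Vmod) (ν : {ν : LogVertex true // ν.IsCross}) :
    (archPlus 𝔄 Vmod).ψAnMono w ν ⋙ (archPlus 𝔄 Vmod).forgetMono w ⋙ (archPlus 𝔄 Vmod).toEmono w =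
      (archPlus 𝔄 Vmod).κAnMono.inverse := rfl

/-- rows 4 → 5 ON THE NOSE: `𝒩_v → 𝒩⊢_v → ℰ⊢` and `𝒩_v → ℰ• → ℰ⊢` are both `(𝕏 ↶ M) ↦ G_𝕏`. [cite: MochizukiAbsTopIII2015, Cor 5.10 p. 146] -/
theorem archPlus_monoN_toEmono_eq (v : Vmod) :
    (archPlus 𝔄 Vmod).monoN v ⋙ (archPlus 𝔄 Vmod).toEmono v = (archPlus 𝔄 Vmod).toE v ⋙ (archPlus 𝔄 Vmod).monoAn := rfl

/-- rows 6 → 7 ON THE NOSE (`κ_{An•,2} = κ_{An•}⁻¹` in abc-iut-w4-d095's holomorphic rows). [cite: MochizukiAbsTopIII2015, Cor 5.10 p. 146] -/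
theorem archPlus_κAn₂_monoAn_eq :
    (archPlus 𝔄 Vmod).κAn₂.functor ⋙ (archPlus 𝔄 Vmod).monoAn = (archPlus 𝔄 Vmod).κAn.inverse ⋙ (archPlus 𝔄 Vmod).monoAn := rfl

/-! ## The mono-analyticization homotopies and Cor 5.10 (iv)(a) at the carrier -/

/-- The add-on `MonoAnalyticizationHomotopies` is INHABITED at the carrier (`toE` canonical, `anToE` = the unit of `TM⊢ ≌ An⊢`).
[cite: MochizukiAbsTopIII2015, Cor 5.10 p. 146] -/
def archPlus_monoAnalyticizationHomotopies : (archPlus 𝔄 Vmod).MonoAnalyticizationHomotopies where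
  toE v := eqToIso (archPlus_monoN_toEmono_eq 𝔄 Vmod v)
  anToE := Functor.isoWhiskerLeft ((archPlus 𝔄 Vmod).κAn.inverse ⋙ (archPlus 𝔄 Vmod).monoAn)
    (archPlus 𝔄 Vmod).κAnMono.unitIso.symm

/-- **[AbsTopIII] Cor 5.10 (iv)(a) HOLDS at the carrier** (`V(F_mod) ≠ ∅`), by the `⋉`-twin of this lineage's `cor510MonoCores_holds`.
[cite: MochizukiAbsTopIII2015, Cor 5.10 (iv)(a) p. 147] -/
theorem archPlus_cor510MonoCores [Nonempty Vmod] : (archPlus 𝔄 Vmod).Cor510MonoCores :=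
  cor510MonoCores_holds (archPlus_monoAnalyticizationHomotopies 𝔄 Vmod)

/-- **Summary**: over the successor interface there IS a carrier whose archimedean `𝒩⊞_v` is `𝒞^hol_{TH⊞}` with print's
`λ⊞^∼`/`λ⊞^×` and the genuine `𝒩⊞_v → TM⊢ × TB⊞` — impossible over the frozen interface (`false_of_tbplus_shapes`).
[cite: MochizukiAbsTopIII2015, Def 5.4 (vi) p. 128] -/
theorem exists_archPlus [Nonempty Vmod] :
    ∃ L : LogFrobeniusSettingLtimes Vmod (fun _ => true),
      L.X = Up (HolTFPair 𝔄) ∧ (∀ v, L.Nplus v = Up (HolTHPlusPair 𝔄)) ∧ L.Emono = TMMono.{u + 1} ∧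
      (∀ v, L.NmonoPlus v = (TMMono.{u + 1} × TBPlus.{u + 1})) ∧ L.AnMono = TMMono.AnArc.{u + 1} ∧ L.Cor510MonoCores :=
  ⟨archPlus 𝔄 Vmod, rfl, fun _ => rfl, rfl, fun _ => rfl, rfl, archPlus_cor510MonoCores 𝔄 Vmod⟩

end LogFrobeniusSettingLtimes

end Literature.AnabelianGeometry.AbsoluteAnabelian

end
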